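import Summits.MatrixMultiplication.OmegaCensus.SmallFormats.MatMul22nGF3MarginalCensus
import Summits.MatrixMultiplication.OmegaCensus.SmallFormats.InvertiblePointDeltaLaw
import HarnessLib

/-!
# ω-census family (a): the `𝔽₃` `⟨2,2,6⟩@20` census reduced to its NO-IP marginals (the δ-law discharges the 1 092 IP-orbits)

Cell `pub-omega` (unit `pub-omega-tensor`, gen 34), topic `Summits/MatrixMultiplication/OmegaCensus` (sub-folder
`SmallFormats`). Framing (verbatim): lottery ticket; floor = certified bounds/negative ranges. HONEST FRAMING: bookkeeping. The
X-marginal census reduction (`MatMul22nGF3MarginalCensus`, tensor g30) makes `r + 1 ≤ R_𝔽₃(⟨2,2,n⟩)` follow from two engine-side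
facts about a list `Reps`: ENUMERATION COMPLETE for the universe `XCaps3 n r` and EVERY REPRESENTATIVE EXCLUDED. The δ-LAW
(`InvertiblePointDeltaLaw`, this generation) adds a KERNEL constraint to the universe whenever `3r ≤ 10n`: at every invertible `X₀`
at most `r − 2n − 1` X-forms vanish (`invLineCapPlus_xMarginal`) — no saturated invertible point ('no IP'). Hence
(`succ_le_tensorRank_22n_gf3_of_noIP_enumeration`) the enumeration hypothesis may be restricted to NO-IP marginals. For
`(n, r) = (6, 20)` (`twentyone_le_tensorRank_226_gf3_of_noIP_enumeration`, `tensorRank_226_gf3_eq_of_noIP_enumeration`) this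
shrinks the engine-side inputs of the sentence 'R_𝔽₃(⟨2,2,6⟩) = 21' from 1 148 orbits (1 092 IP + 56 no-IP, census of tensor
g23–g26 / ENG1, engine ×2) to the 56 NO-IP orbits: their enumeration and their 56 exclusions (near-frame searches, engine ×2,
Pa24–Pa38) remain engine-side and are NOT proved here. Nothing in this file is the statement 'R_𝔽₃(⟨2,2,6⟩) = 21' and nothing is
a bound on `ω`.
-/

namespace Summit.MatrixMultiplication.OmegaCensus.RankOnePlaneCapGeneral

open Module Matrix Literature.Computability.AlgebraicComplexity
open Summit.MatrixMultiplication.OmegaCensus.SmallFormats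

variable {n : ℕ}

/-- **The δ-law as a cap on the X-marginal** (`𝔽₃`, any rung with `3r ≤ 10n`, `n ≥ 1`): at every invertible `X₀` at most
`r − 2n − 1` coefficient matrices of the X-marginal are orthogonal to `X₀` — one better than the invertible line cap of `XCaps3`. -/
theorem invLineCapPlus_xMarginal {r : ℕ} (hn : 0 < n) (h3 : 3 * r ≤ 10 * n)
    (β : BilinComp (mulBilin (ZMod 3) 2 2 n) (Fin r)) (X₀ : Matrix (Fin 2) (Fin 2) (ZMod 3)) (hX₀ : X₀.det ≠ 0) :
    2 * n + 1 + (Finset.univ.filter fun i => dotX (mflat (xMarginal β i)) X₀ = 0).card ≤ r := by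
  have h1 := DeltaLaw.two_mul_add_one_le_card_filter_ne hn β (by rw [Fintype.card_fin]; exact h3) X₀
    (isUnit_iff_ne_zero.mpr hX₀)
  change 2 * n + 1 ≤ (Finset.univ.filter fun i => ¬ β.f i X₀ = 0).card at h1
  have hsplit := Finset.card_filter_add_card_filter_not (s := (Finset.univ : Finset (Fin r)))
    (fun i => β.f i X₀ = 0)
  rw [Finset.card_univ, Fintype.card_fin] at hsplit
  have hcongr : (Finset.univ.filter fun i => dotX (mflat (xMarginal β i)) X₀ = 0) =
      Finset.univ.filter fun i => β.f i X₀ = 0 := by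
    refine Finset.filter_congr fun i _ => ?_
    rw [f_apply_eq_dotX]
  rw [hcongr]
  omega

/-- **Census reduction with the no-IP universe** (`𝔽₃`, floor rung `r ≤ R_𝔽₃(⟨2,2,n⟩)`, `3r ≤ 10n`): IF every nowhere-zero `m`
in `XCaps3 n r` that moreover has NO saturated invertible point (`2n + 1 + #{i : m_i ⊥ X₀} ≤ r` for every invertible `X₀`) is
`InOrbit`-related to a member of `Reps`, AND no member of `Reps` is an X-marginal, THEN `r + 1 ≤ R_𝔽₃(⟨2,2,n⟩)`. Both hypotheses
are engine-side; the restriction of the universe is the kernel δ-law. -/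
theorem succ_le_tensorRank_22n_gf3_of_noIP_enumeration (r : ℕ) (hn : 0 < n) (h3 : 3 * r ≤ 10 * n)
    (hr : r ≤ tensorRank (matMulTensor (ZMod 3) 2 2 n))
    (Reps : Set (Fin r → Matrix (Fin 2) (Fin 2) (ZMod 3)))
    (henum : ∀ m : Fin r → Matrix (Fin 2) (Fin 2) (ZMod 3), (∀ i, m i ≠ 0) → XCaps3 n r m →
      (∀ X₀ : Matrix (Fin 2) (Fin 2) (ZMod 3), X₀.det ≠ 0 →
        2 * n + 1 + (Finset.univ.filter fun i => dotX (mflat (m i)) X₀ = 0).card ≤ r) →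
      ∃ rep ∈ Reps, InOrbit m rep)
    (hexcl : ∀ rep ∈ Reps, ∀ β : BilinComp (mulBilin (ZMod 3) 2 2 n) (Fin r), xMarginal β ≠ rep) :
    r + 1 ≤ tensorRank (matMulTensor (ZMod 3) 2 2 n) :=
  succ_le_tensorRank_22n_of_orbit_census r Reps
    (fun β => henum _ (xMarginal_ne_zero_of_le_tensorRank hr β) (xCaps3_xMarginal β)
      (fun X₀ hX₀ => invLineCapPlus_xMarginal hn h3 β X₀ hX₀)) hexcl

/-- **The `⟨2,2,6⟩@20` cell with the no-IP universe.** With the kernel floor `20 ≤ R_𝔽₃(⟨2,2,6⟩)` and the kernel δ-law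
(`3·20 ≤ 10·6`): IF the census's list `Reps` of NO-IP representatives at `(6, 20)` (engine-side: 56 orbits) is complete for the
no-IP universe AND every one of them is excluded (engine-side: the near-frame searches), THEN `21 ≤ R_𝔽₃(⟨2,2,6⟩)`. NOT proved
unconditionally here. -/
theorem twentyone_le_tensorRank_226_gf3_of_noIP_enumeration
    (Reps : Set (Fin 20 → Matrix (Fin 2) (Fin 2) (ZMod 3)))
    (henum : ∀ m : Fin 20 → Matrix (Fin 2) (Fin 2) (ZMod 3), (∀ i, m i ≠ 0) → XCaps3 6 20 m →
      (∀ X₀ : Matrix (Fin 2) (Fin 2) (ZMod 3), X₀.det ≠ 0 →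
        2 * 6 + 1 + (Finset.univ.filter fun i => dotX (mflat (m i)) X₀ = 0).card ≤ 20) →
      ∃ rep ∈ Reps, InOrbit m rep)
    (hexcl : ∀ rep ∈ Reps, ∀ β : BilinComp (mulBilin (ZMod 3) 2 2 6) (Fin 20), xMarginal β ≠ rep) :
    21 ≤ tensorRank (matMulTensor (ZMod 3) 2 2 6) :=
  succ_le_tensorRank_22n_gf3_of_noIP_enumeration 20 (by norm_num) (by norm_num)
    (by have h := (tensorRank_matMulTensor_22n_gf3_window 6 (by norm_num)).1; omega) Reps henum hexcl

/-- **The `⟨2,2,6⟩@20` cell, no-IP universe, with the Hopcroft–Kerr ceiling `21`:** under the same two engine-side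
hypotheses, `R_𝔽₃(⟨2,2,6⟩) = 21`. NOT proved unconditionally here. -/
theorem tensorRank_226_gf3_eq_of_noIP_enumeration
    (Reps : Set (Fin 20 → Matrix (Fin 2) (Fin 2) (ZMod 3)))
    (henum : ∀ m : Fin 20 → Matrix (Fin 2) (Fin 2) (ZMod 3), (∀ i, m i ≠ 0) → XCaps3 6 20 m →
      (∀ X₀ : Matrix (Fin 2) (Fin 2) (ZMod 3), X₀.det ≠ 0 →
        2 * 6 + 1 + (Finset.univ.filter fun i => dotX (mflat (m i)) X₀ = 0).card ≤ 20) →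
      ∃ rep ∈ Reps, InOrbit m rep)
    (hexcl : ∀ rep ∈ Reps, ∀ β : BilinComp (mulBilin (ZMod 3) 2 2 6) (Fin 20), xMarginal β ≠ rep) :
    tensorRank (matMulTensor (ZMod 3) 2 2 6) = 21 := by
  have h1 := twentyone_le_tensorRank_226_gf3_of_noIP_enumeration Reps henum hexcl
  have h2 := hopcroftKerr1971_tensorRank_matMulTensor_22n_le (K := ZMod 3) 6
  omega

end Summit.MatrixMultiplication.OmegaCensus.RankOnePlaneCapGeneral
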